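import Mathlib.Tactic.Group
import Literature.AnabelianGeometry.SemiGraphs.NotationsConventions

/-!
# [SemiAnbd] §0: the exact sequence `1 → G → G ⋊^out J → J → 1` — proof of the named fact

Mochizuki, *Semi-graphs of anabelioids*, Publ. RIMS **42** (2006) 221–322, §0 "Topological Groups",
author's manuscript p. 5 [cite: MochizukiSemiAnbd2006, §0 p.5]: for a centre-free topological group
`G` and `J → Out(G)`, "we have a natural exact sequence `1 → G → G ⋊^out J → J → 1`".
Proof-only companion (no definitions) of `NotationsConventions.lean` (p404624): it DISCHARGES the
named fact `outerSemidirectProduct_exact` exactly as typed there —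

* injectivity of `G → G ⋊^out J = Aut(G) ×_{Out(G)} J`, `g ↦ (conj g, 1)`: `conj g = conj h` puts
  `h⁻¹ g` in the centre, which is trivial (the only place the hypothesis `Z(G) = 1` is used);
* exactness in the middle: the kernel of the projection to `J` consists of the pairs `(φ, 1)` with
  `φ` inner, i.e. of the image of `G`;
* surjectivity onto `J`: lift `ρ j ∈ Out(G)` to an automorphism.

Nothing of the statement file is restated.
-/

namespace Literature.AnabelianGeometry.SemiGraphs

open Literature.AnabelianGeometry.EtaleTheta

/-- [SemiAnbd] §0 p. 5 — DISCHARGED: for centre-free `G` and `ρ : J → Out(G)` the sequence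
`1 → G → G ⋊^out J → J → 1` is exact (injectivity of `toOuterSemidirectProduct ρ`, its range is the
kernel of `outerSemidirectProductSnd ρ`, and the latter is surjective).
[cite: MochizukiSemiAnbd2006, §0 p.5] -/
theorem outerSemidirectProduct_exact_holds : outerSemidirectProduct_exact := by
  intro G _ _ _ hZ J _ ρ
  refine ⟨?_, ?_, ?_⟩
  · -- injectivity: `conj` is injective on a centre-free group
    intro g h heq
    have hc : MulAut.conj g = MulAut.conj h :=
      congrArg (fun p : outerSemidirectProduct ρ => (p.1.1 : MulAut G)) heq
    have hz : h⁻¹ * g ∈ Subgroup.center G := by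
      rw [Subgroup.mem_center_iff]
      intro x
      have hx := DFunLike.congr_fun hc x
      simp only [MulAut.conj_apply] at hx
      calc x * (h⁻¹ * g) = h⁻¹ * (h * x * h⁻¹) * g := by group
        _ = h⁻¹ * (g * x * g⁻¹) * g := by rw [hx]
        _ = h⁻¹ * g * x := by group
    rw [hZ, Subgroup.mem_bot] at hz
    exact (inv_mul_eq_one.mp hz).symm
  · -- exactness in the middle
    ext p
    constructor
    · rintro ⟨g, rfl⟩
      exact (outerSemidirectProductSnd ρ).mem_ker.mpr rfl
    · intro hp
      have hp2 : p.1.2 = 1 := (outerSemidirectProductSnd ρ).mem_ker.mp hp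
      have hmem : TopOut.mk G p.1.1 = ρ p.1.2 := p.2
      rw [hp2, map_one, QuotientGroup.mk'_apply, QuotientGroup.eq_one_iff,
        Subgroup.mem_subgroupOf] at hmem
      obtain ⟨g, hg⟩ := hmem
      refine ⟨g, Subtype.ext (Prod.ext (Subtype.ext hg) hp2.symm)⟩
  · -- surjectivity onto `J`
    intro j
    obtain ⟨φ, hφ⟩ := QuotientGroup.mk_surjective (ρ j)
    exact ⟨⟨(φ, j), hφ⟩, rfl⟩

end Literature.AnabelianGeometry.SemiGraphs
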